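import Literature.IUT.HodgeTheaters.InitialThetaDataTorsionCuspModelCuspSpan
import Literature.IUT.HodgeTheaters.PuncturedEllipticCoveringsModLCuspLaws
import Literature.IUT.HodgeTheaters.PuncturedEllipticCoveringsArrowClaimsOfLawsIndex
import Literature.IUT.HodgeTheaters.PuncturedEllipticCoveringsArrowClaimsOfModLCuspLaws
import HarnessLib

/-!
# [IUTchI] §1 pp.37–38: abc-iut-L5-t1's `Δ_ε`-LAWS `ModLCuspLaws` HOLD at the group-ring two-step model `pedOf₃` /
# `regeom₃` — JOINTLY with `CuspGalois`, the `l`-torsion monodromy `M′ ⊇ {M, hI}`, and hence `ArrowCoveringClaims`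
# (NV-L5 row «JOINT-NV-CG (l cusps)», part B5c = the laws + B6 = the joint statement)

S. Mochizuki, *Inter-universal Teichmüller theory I*, kurims manuscript (May 2020), §1 p. 37 l. 30 – p. 38 l. 24
(«`Δ_X̲ ↠ Δ_X̲^{ab} ⊗ (ℤ/lℤ) ↠ Δ_ε` … `0 → I_{ε′} × I_{ε″} → Δ_ε → Δ_E ⊗ (ℤ/lℤ) → 0` … `I_{ε′} ≅ ℤ/lℤ ≅ I_{ε″}` … `ι`
acts on `Δ_E ⊗ (ℤ/lℤ)` via multiplication by `−1` … the natural [outer] action of `G_k` on `Δ_ε⁺ × Gal(X̲/C̲)` is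
trivial») — quoted by the six fields (L0)–(L4) of `PuncturedEllipticData.ModLCuspLaws` (abc-iut-L5-t1, p446054).
[claim: Mochizuki2012, status: disputed] (D-0012 claim key; series status DISPUTED — a MODEL of the cell's `π₁`-interface
structures; nothing of the series is asserted; no side taken on [IUTchIII] Cor. 3.12).

## WHAT (parts B1–B5b landed: p454544, p455671, p456777, p459626, p466318, B5b `…CuspModelCuspSpan`)

* the twisted additivity of the total augmentation on `DihU = (U ⋊ E[l]) ⋊ {±1}`: `ε((d₁d₂)_U) = ε(d₁,U) + ε(u₁)·ε(d₂,U)`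
  (`augE_mul`), whence **`augE_conj_mul_self`**: `ε((c v c⁻¹ v)_U) = 0` for `u_c = −1`, `u_v = 1`; with
  `conj_mul_self_eq_embU` (`c v c⁻¹ v = embU(w)`, its `E[l]`- and `{±1}`-parts being trivial) and B5b's
  `mem_cuspSpan_of_totSum_eq_zero` this is **(L3) `iota_neg₃`**: `ι̲ v ι̲⁻¹ v ∈ I_{ε′} · I_{ε″} · Ker(Δ_X̲ ↠ Δ_ε)`;
* (L0) `modLKer_relIndex_ne_zero₃` (`Δ_X̲` finite), (L1) `inertia_procyclic₃` (`I_x = ⟨(1, igen_x)⟩`),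
  (L2a) **`inertia_ε1_image_order₃`** and (L2c) **`inertia_images_inf_le₃`** by the coset functional `Λ_h` of part B5a
  (`Λ_h` kills `Ker(Δ_X̲ ↠ Δ_ε)` and `I_{ε″}`, `Λ_h(igen_{ε′}) = −1`; t1's generic `relIndex_eq_of_le_zpowers_sup` and
  `normal_subgroupOf_of_modLKer_le` BY NAME), (L4) = B5a's `inertia_central₃`;
* **`modLCuspLaws₃ : (pedOf₃ …).ModLCuspLaws`**, **`InitialThetaData.modLCuspLawsRegeom₃ D₀ : D₀.regeom₃.geom.pe.ModLCuspLaws`**,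
  **`arrowCoveringClaimsRegeom₃`** (t1's `arrowCoveringClaims_pe_of_modLCuspLaws` BY NAME, p448117), and the JOINT
  NON-VACUITY **`InitialThetaData.exists_joint_cuspGalois_unramified_laws_claims`**: for every `D₀` a datum `D` over the
  SAME `(V^bad_mod, V̲)` carrying `{CG, M′ : UnramifiedTorsionMonodromy (⊇ M, hI), hL : ModLCuspLaws, hA :
  ArrowCoveringClaims}` — the binders of abc-iut-L5-d5's `Λ`-assembly (p446888) and abc-iut-L5-t4's kits (p448457) except
  `hS`, jointly consistent; impossible at every earlier model of the cell (4-label data: `IsEmpty CuspGalois`,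
  `¬ArrowCoveringClaims`; product ambients: no `M`).

HONEST LABEL «[model; `E[l]`-twisted finite shadow `U ⋊ E[l]`; `l` cusps; CG + hL + hA + M′ INHABITED jointly]»; `hS`
(`CuspClassesNormaliserStable`) at this datum is NOT claimed here.  Model ≠ genuine datum; a model witnesses consistency
of OUR typed binders only; typed ≠ proved; no side taken on [IUTchIII] Cor. 3.12.
-/

noncomputable section

namespace Literature.IUT.HodgeTheaters

universe u

namespace TorsionCuspModel
open Literature.AnabelianGeometry.AbsoluteAnabelian Topology TorsionMonodromyModel
open Literature.AnabelianGeometry.EtaleTheta.SettingModel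
open scoped WeierstrassCurve.Affine Classical Pointwise

variable {F : Type u} [Field F] {E : WeierstrassCurve F} {Fbar : Type u} [Field Fbar] [Algebra F Fbar] {l : ℕ}
  [E.IsElliptic] [NeZero l]

/-! ## The twisted additivity of the total augmentation on `DihU` -/

/-- `ε(d_U)`: the total augmentation of the `U`-part of `d ∈ DihU`. [cite: Mochizuki2012, IUTchI §1 p.38] -/
def augE (d : DihU F E Fbar l) : ZMod l := totSum (E := E) (Multiplicative.toAdd d.left.left)

/-- **Twisted additivity** `ε((d₁d₂)_U) = ε(d₁,U) + ε(u₁)·ε(d₂,U)`. [cite: Mochizuki2012, IUTchI §1 p.38] -/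
theorem augE_mul (d₁ d₂ : DihU F E Fbar l) : augE (d₁ * d₂) = augE d₁ + ((d₁.right : ℤ) : ZMod l) * augE d₂ := by
  rw [augE, augE, augE, SemidirectProduct.mul_left, SemidirectProduct.mul_left, toAdd_mul, map_add, totSum_transl,
    outerK_apply, outer_apply_left, totSum_outU_inr]

/-- [cite: Mochizuki2012, IUTchI §1 p.38] -/
theorem augE_one : augE (1 : DihU F E Fbar l) = 0 := by
  rw [augE, SemidirectProduct.one_left, SemidirectProduct.one_left, toAdd_one, map_zero]

/-- `ε((d⁻¹)_U) = −ε(u_d)·ε(d_U)`. [cite: Mochizuki2012, IUTchI §1 p.38] -/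
theorem augE_inv (d : DihU F E Fbar l) : augE d⁻¹ = -(((d.right : ℤ) : ZMod l) * augE d) := by
  have h0 := augE_mul d d⁻¹
  rw [mul_inv_cancel, augE_one] at h0
  have hs : ((d.right : ℤ) : ZMod l) * ((d.right : ℤ) : ZMod l) = 1 := by
    rw [← Int.cast_mul, ← Units.val_mul, Int.units_mul_self, Units.val_one, Int.cast_one]
  calc augE d⁻¹ = ((d.right : ℤ) : ZMod l) * (((d.right : ℤ) : ZMod l) * augE d⁻¹) := by rw [← mul_assoc, hs, one_mul]
    _ = ((d.right : ℤ) : ZMod l) * (-augE d) := by rw [eq_neg_of_add_eq_zero_right h0.symm]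
    _ = -(((d.right : ℤ) : ZMod l) * augE d) := mul_neg _ _

/-- **`ε((c v c⁻¹ v)_U) = 0`** for `u_c = −1`, `u_v = 1` («`ι` acts on `Δ_E ⊗ ℤ/l` by `−1`»: `ε(ι̲ v ι̲⁻¹) = −ε(v)`).
[cite: Mochizuki2012, IUTchI §1 p.38] -/
theorem augE_conj_mul_self {c v : DihU F E Fbar l} (hc : c.right = -1) (hv : v.right = 1) :
    augE (c * v * c⁻¹ * v) = 0 := by
  rw [augE_mul, augE_mul, augE_mul, augE_inv]
  simp only [SemidirectProduct.mul_right, SemidirectProduct.inv_right, Int.units_inv_eq_self, hc, hv, mul_one,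
    Int.units_mul_self, Units.val_neg, Units.val_one, Int.cast_neg, Int.cast_one]
  ring

omit [E.IsElliptic] [NeZero l] in
/-- For `c = (1, c₂)` with `u_c = −1` and `v = (1, v₂)` with `u_v = 1`: `c v c⁻¹ v = embU (w)` — its `E[l]`-part is
`t_c t_v⁻¹ t_c⁻¹ t_v = 1` and its `{±1}`-part is `1`. [cite: Mochizuki2012, IUTchI §1 p.38] -/
theorem conj_mul_self_eq_embU (G : Type u) [Group G] {c v : G × DihU F E Fbar l} (hc1 : c.1 = 1) (hcu : c.2.right = -1)
    (hv1 : v.1 = 1) (hvu : v.2.right = 1) :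
    c * v * c⁻¹ * v = embU G (c.2 * v.2 * c.2⁻¹ * v.2).left.left := by
  have hr : (c.2 * v.2 * c.2⁻¹ * v.2).right = 1 := by
    rw [SemidirectProduct.mul_right, SemidirectProduct.mul_right, SemidirectProduct.mul_right,
      SemidirectProduct.inv_right, hcu, hvu, mul_one, mul_one, Int.units_inv_eq_self, Int.units_mul_self]
  have ht : (c.2 * v.2 * c.2⁻¹ * v.2).left.right = 1 := by
    have key : (proj F E Fbar l (c.2 * v.2 * c.2⁻¹ * v.2)).left = 1 := by
      rw [map_mul, map_mul, map_mul, map_inv]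
      simp only [SemidirectProduct.mul_left, SemidirectProduct.inv_left, SemidirectProduct.mul_right,
        SemidirectProduct.inv_right, proj_apply_right, hcu, hvu, mul_one, Int.units_inv_eq_self,
        Int.units_mul_self, map_one, MulAut.one_apply, sgnRep_apply_eq_zpow, Units.val_neg, Units.val_one,
        zpow_neg, zpow_one, inv_inv]
      rw [mul_comm _ (proj F E Fbar l c.2).left⁻¹, inv_mul_cancel_left, inv_mul_cancel]
    rwa [proj_apply_left] at key
  refine Prod.ext ?_ (SemidirectProduct.ext (SemidirectProduct.ext rfl ht) hr)
  show c.1 * v.1 * c.1⁻¹ * v.1 = 1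
  simp only [hc1, hv1, mul_one, inv_one]

/-! ## The laws at `pedOf₃` -/

section Laws

variable (G : Type u) [Group G] [TopologicalSpace G] [IsTopologicalGroup G] [CompactSpace G]
  [TotallyDisconnectedSpace G]
  {g : Tors E Fbar l} (s : Tors E Fbar l ⧸ Subgroup.zpowers g → Tors E Fbar l) (h a : Tors E Fbar l)
  (hl : l.Prime) (ha : a ∉ Subgroup.zpowers g) (h5 : 5 ≤ l) (h6 : l.Coprime 6) (hg : g ≠ 1)
  (hcard : Nat.card (Tors E Fbar l) = l ^ 2)
  (hs : ∀ q : Tors E Fbar l ⧸ Subgroup.zpowers g, (QuotientGroup.mk (s q) : _ ⧸ Subgroup.zpowers g) = q)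
  (hh : h ^ 2 = a)

/-- LOWER BOUND for `I_{ε′} · I_{ε″} · Ker(Δ_X̲ ↠ Δ_ε)`: it contains `embU (cuspSpan)`. [cite: Mochizuki2012, IUTchI §1 p.37] -/
theorem map_embU_cuspSpan_le₃ : (cuspSpan s h).map (embU G) ≤
    (pedOf₃ F E Fbar l G g s h a hl ha h5 h6).inertia (pedOf₃ F E Fbar l G g s h a hl ha h5 h6).ε1 ⊔
      (pedOf₃ F E Fbar l G g s h a hl ha h5 h6).inertia (pedOf₃ F E Fbar l G g s h a hl ha h5 h6).ε2 ⊔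
      (pedOf₃ F E Fbar l G g s h a hl ha h5 h6).deltaEpsKer := by
  rw [Subgroup.map_le_iff_le_comap, cuspSpan]
  refine sup_le (fun w hw => ?_) (iSup_le fun x => ?_)
  · exact ((pedOf₃ F E Fbar l G g s h a hl ha h5 h6).modLKer_le_deltaEpsKer.trans le_sup_right)
      (embU_mem_modLKer₃_of_mem_cob G s h a hl ha h5 h6 hw)
  · rw [Subgroup.zpowers_le, Subgroup.mem_comap]
    obtain ⟨x, hx0⟩ := x
    have hI : embU G (ivec s h x) ∈ (pedOf₃ F E Fbar l G g s h a hl ha h5 h6).inertia x :=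
      (mem_inertia₃ G s h a hl ha h5 h6).mpr ⟨rfl, Subgroup.mem_zpowers _⟩
    rcases eq_or_ne x (QuotientGroup.mk a) with h1 | h1
    · subst h1
      exact Subgroup.mem_sup_left (Subgroup.mem_sup_left hI)
    rcases eq_or_ne x (QuotientGroup.mk a)⁻¹ with h2 | h2
    · subst h2
      exact Subgroup.mem_sup_left (Subgroup.mem_sup_right hI)
    · refine Subgroup.mem_sup_right (Subgroup.mem_sup_right ?_)
      exact le_iSup (fun y : {y : (pedOf₃ F E Fbar l G g s h a hl ha h5 h6).Cusp //
          (pedOf₃ F E Fbar l G g s h a hl ha h5 h6).IsNonzeroCusp y ∧ y ≠ (pedOf₃ F E Fbar l G g s h a hl ha h5 h6).ε1 ∧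
            y ≠ (pedOf₃ F E Fbar l G g s h a hl ha h5 h6).ε2} =>
          (pedOf₃ F E Fbar l G g s h a hl ha h5 h6).inertia y.1) ⟨x, hx0, h1, h2⟩ hI

include hg hcard hs hh in
/-- **(L3) at the model** — «`ι` acts on `Δ_E ⊗ (ℤ/lℤ)` via multiplication by `−1`»: for `ι̲ ∈ Δ_C̲ ∖ Δ_X̲` and
`v ∈ Δ_X̲`, `ι̲ v ι̲⁻¹ v = embU(w)` with `ε(w) = 0`, so `w ∈ cuspSpan` and `ι̲ v ι̲⁻¹ v ∈ I_{ε′}·I_{ε″}·Ker(Δ_X̲ ↠ Δ_ε)`.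
[cite: Mochizuki2012, IUTchI §1 p.38] -/
theorem iota_neg₃ (c : (pedOf₃ F E Fbar l G g s h a hl ha h5 h6).PiC)
    (hc : c ∈ (pedOf₃ F E Fbar l G g s h a hl ha h5 h6).DeltaCbar)
    (hcX : c ∉ (pedOf₃ F E Fbar l G g s h a hl ha h5 h6).DeltaXbar) (v : (pedOf₃ F E Fbar l G g s h a hl ha h5 h6).PiC)
    (hv : v ∈ (pedOf₃ F E Fbar l G g s h a hl ha h5 h6).DeltaXbar) :
    c * v * c⁻¹ * v ∈ (pedOf₃ F E Fbar l G g s h a hl ha h5 h6).inertia (pedOf₃ F E Fbar l G g s h a hl ha h5 h6).ε1 ⊔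
      (pedOf₃ F E Fbar l G g s h a hl ha h5 h6).inertia (pedOf₃ F E Fbar l G g s h a hl ha h5 h6).ε2 ⊔
      (pedOf₃ F E Fbar l G g s h a hl ha h5 h6).deltaEpsKer := by
  obtain ⟨hc1, hct⟩ := (mem_deltaCbar₃ G s h a hl ha h5 h6).mp hc
  have hcu : c.2.right = -1 := (Int.units_eq_one_or c.2.right).resolve_left fun h1 =>
    hcX ((mem_deltaXbar₃ G s h a hl ha h5 h6).mpr ⟨hc1, h1, hct⟩)
  obtain ⟨hv1, hvu, -⟩ := (mem_deltaXbar₃ G s h a hl ha h5 h6).mp hv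
  have e := conj_mul_self_eq_embU G hc1 hcu hv1 hvu
  have hε : totSum (E := E) (Multiplicative.toAdd (c.2 * v.2 * c.2⁻¹ * v.2).left.left) = 0 := augE_conj_mul_self hcu hvu
  have hw := mem_cuspSpan_of_totSum_eq_zero h hs hl hg hcard ha hh hε
  exact e ▸ map_embU_cuspSpan_le₃ G s h a hl ha h5 h6 ⟨_, hw, rfl⟩

/-- **(L0) at the model**: `Δ_X̲` is finite, so `[Δ_X̲ : Ker(Δ_X̲ ↠ Δ_X̲^{ab} ⊗ ℤ/l)] ≠ 0`. [cite: Mochizuki2012, IUTchI §1 p.37] -/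
theorem modLKer_relIndex_ne_zero₃ :
    (pedOf₃ F E Fbar l G g s h a hl ha h5 h6).modLKer.relIndex (pedOf₃ F E Fbar l G g s h a hl ha h5 h6).DeltaXbar ≠ 0 := by
  haveI := finite_deltaXbar₃ G s h a hl ha h5 h6
  rw [Subgroup.relIndex]
  exact Subgroup.index_ne_zero_of_finite

/-- **(L1) at the model**: `I_x = ⟨(1, igen_x)⟩` is (pro)cyclic. [cite: Mochizuki2012, IUTchI §1 p.37] -/
theorem inertia_procyclic₃ (q : Tors E Fbar l ⧸ Subgroup.zpowers g) :
    ∃ z ∈ (pedOf₃ F E Fbar l G g s h a hl ha h5 h6).inertia q,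
      (pedOf₃ F E Fbar l G g s h a hl ha h5 h6).inertia q ≤ (Subgroup.zpowers z).topologicalClosure := by
  refine ⟨embU G (ivec s h q), (mem_inertia₃ G s h a hl ha h5 h6).mpr ⟨rfl, Subgroup.mem_zpowers _⟩, fun x hx => ?_⟩
  obtain ⟨n, rfl⟩ := eq_embU_of_mem_inertia₃ G s h a hl ha h5 h6 hx
  refine Subgroup.le_topologicalClosure _ ?_
  rw [map_zpow]
  exact Subgroup.zpow_mem _ (Subgroup.mem_zpowers _) n

include hs hh in
/-- **(L2a) at the model** — «`I_{ε′} ≅ ℤ/lℤ`» in `Δ_ε`: `[I_{ε′}·Ker : Ker] = l`, detected by the coset functional `Λ_h`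
(`Λ_h` kills `Ker(Δ_X̲ ↠ Δ_ε)`, `Λ_h(igen_{ε′}) = −1`). [cite: Mochizuki2012, IUTchI §1 p.37] -/
theorem inertia_ε1_image_order₃ :
    (pedOf₃ F E Fbar l G g s h a hl ha h5 h6).deltaEpsKer.relIndex
      ((pedOf₃ F E Fbar l G g s h a hl ha h5 h6).inertia (pedOf₃ F E Fbar l G g s h a hl ha h5 h6).ε1 ⊔
        (pedOf₃ F E Fbar l G g s h a hl ha h5 h6).deltaEpsKer) = (pedOf₃ F E Fbar l G g s h a hl ha h5 h6).l := by
  have hz : embU G (ivec s h (QuotientGroup.mk a)) ∈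
      (pedOf₃ F E Fbar l G g s h a hl ha h5 h6).inertia (pedOf₃ F E Fbar l G g s h a hl ha h5 h6).ε1 :=
    (mem_inertia₃ G s h a hl ha h5 h6).mpr ⟨rfl, Subgroup.mem_zpowers _⟩
  refine PuncturedEllipticData.relIndex_eq_of_le_zpowers_sup le_sup_right
    (PuncturedEllipticData.normal_subgroupOf_of_modLKer_le (pedOf₃ F E Fbar l G g s h a hl ha h5 h6).modLKer_le_deltaEpsKer
      le_sup_right (sup_le ((pedOf₃ F E Fbar l G g s h a hl ha h5 h6).inertia_le_deltaXbar _)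
        (pedOf₃ F E Fbar l G g s h a hl ha h5 h6).deltaEpsKer_le_deltaXbar))
    (Subgroup.mem_sup_left hz) (sup_le (fun x hx => ?_) le_sup_right) ?_ fun d hd => ?_
  · obtain ⟨n, rfl⟩ := eq_embU_of_mem_inertia₃ G s h a hl ha h5 h6 hx
    refine Subgroup.mem_sup_left ?_
    rw [map_zpow]
    exact Subgroup.zpow_mem _ (Subgroup.mem_zpowers _) n
  · show embU G (ivec s h (QuotientGroup.mk a)) ^ l ∈ (pedOf₃ F E Fbar l G g s h a hl ha h5 h6).deltaEpsKer
    rw [← map_pow, U.pow_l, map_one]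
    exact one_mem _
  · have hd' : embU G (ivec s h (QuotientGroup.mk a) ^ (d : ℤ)) ∈ (pedOf₃ F E Fbar l G g s h a hl ha h5 h6).deltaEpsKer := by
      rw [map_zpow, zpow_natCast]; exact hd
    have := cast_eq_zero_of_embU_ivec_ε1_zpow_mem G s h a hl ha h5 h6 hs hh
      (deltaEpsKer_le_lamKer₃ G s h a hl ha h5 h6 hs hh hd')
    rw [Int.cast_natCast] at this
    exact (ZMod.natCast_eq_zero_iff d l).mp this

include hs hh in
/-- **(L2c) at the model** — «`0 → I_{ε′} × I_{ε″} → Δ_ε`»: `I_{ε′} ∩ (I_{ε″}·Ker) ⊆ Ker` (the only multiple of `igen_{ε′}`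
killed by `Λ_h` is trivial). [cite: Mochizuki2012, IUTchI §1 p.37] -/
theorem inertia_images_inf_le₃ :
    (pedOf₃ F E Fbar l G g s h a hl ha h5 h6).inertia (pedOf₃ F E Fbar l G g s h a hl ha h5 h6).ε1 ⊓
        ((pedOf₃ F E Fbar l G g s h a hl ha h5 h6).inertia (pedOf₃ F E Fbar l G g s h a hl ha h5 h6).ε2 ⊔
          (pedOf₃ F E Fbar l G g s h a hl ha h5 h6).deltaEpsKer) ≤
      (pedOf₃ F E Fbar l G g s h a hl ha h5 h6).deltaEpsKer := by
  intro x hx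
  obtain ⟨hx1, hx2⟩ := Subgroup.mem_inf.mp hx
  obtain ⟨n, rfl⟩ := eq_embU_of_mem_inertia₃ G s h a hl ha h5 h6 hx1
  have hM := sup_le (inertia_le_lamKer₃ G s h a hl ha h5 h6 hs hh (pedOf₃ F E Fbar l G g s h a hl ha h5 h6).ε2_ne_ε0
    (pedOf₃ F E Fbar l G g s h a hl ha h5 h6).ε1_ne_ε2.symm) (deltaEpsKer_le_lamKer₃ G s h a hl ha h5 h6 hs hh) hx2
  have h0 := cast_eq_zero_of_embU_ivec_ε1_zpow_mem G s h a hl ha h5 h6 hs hh hM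
  rw [U.zpow_eq_one_of_cast_eq_zero _ h0, map_one]
  exact one_mem _

include hg hcard hs hh in
/-- **NV: abc-iut-L5-t1's `ModLCuspLaws` HOLDS at the `K`-level datum `pedOf₃`** of the group-ring two-step model (all
six laws (L0)–(L4); `#E[l] = l²`, `g ≠ 1`, `s` a section, `h² = a ∉ ℤ·g`). [cite: Mochizuki2012, IUTchI §1 pp.37–38] -/
theorem modLCuspLaws₃ : (pedOf₃ F E Fbar l G g s h a hl ha h5 h6).ModLCuspLaws where
  modLKer_relIndex_ne_zero := modLKer_relIndex_ne_zero₃ G s h a hl ha h5 h6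
  inertia_procyclic := inertia_procyclic₃ G s h a hl ha h5 h6
  inertia_ε1_image_order := inertia_ε1_image_order₃ G s h a hl ha h5 h6 hs hh
  inertia_images_inf_le := inertia_images_inf_le₃ G s h a hl ha h5 h6 hs hh
  iota_neg := iota_neg₃ G s h a hl ha h5 h6 hg hcard hs hh
  inertia_central := inertia_central₃ G s h a hl ha h5 h6

end Laws

end TorsionCuspModel

/-! ## At the re-geometrised initial Θ-datum `regeom₃`: the laws, the printed claims, and the JOINT statement -/

namespace InitialThetaData

open Literature.AnabelianGeometry.AbsoluteAnabelian TorsionMonodromyModel TorsionCuspModel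
open scoped WeierstrassCurve.Affine Classical

variable {F K Fbar : Type u} [Field F] [NumberField F] [Field K] [NumberField K] [Algebra F K] [Field Fbar]
  [Algebra F Fbar] [Algebra K Fbar] {E : WeierstrassCurve F} [E.IsElliptic] {l : ℕ} {Pb : BadPlacePredicates K}

/-- **abc-iut-L5-t1's `ModLCuspLaws` at `regeom₃`** (`s := Quotient.out`, `h := a^{(l+1)/2}`).
[cite: Mochizuki2012, IUTchI §1 pp.37–38] -/
theorem modLCuspLawsRegeom₃ (D₀ : InitialThetaData F K Fbar E l Pb) : D₀.regeom₃.geom.pe.ModLCuspLaws := by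
  haveI := D₀.isAlgClosure
  haveI := D₀.isScalarTower
  haveI : NeZero l := ⟨D₀.l_prime.ne_zero⟩
  haveI : CompactSpace (galoisSubgroupOf F K Fbar) :=
    isCompact_iff_compactSpace.mp (ThetaGeometryModel.isClosed_galoisSubgroupOf F K Fbar).isCompact
  have hh : (D₀.coGen ^ ((l + 1) / 2)) ^ 2 = D₀.coGen := by
    have hodd : l % 2 = 1 := Nat.odd_iff.mp (D₀.l_prime.odd_of_ne_two (by have := D₀.five_le_l; omega))
    have h2 : (l + 1) / 2 * 2 = l + 1 := by omega
    rw [← pow_mul, h2, pow_succ, Tors.pow_l, one_mul]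
  exact TorsionCuspModel.modLCuspLaws₃ (galoisSubgroupOf F K Fbar) Quotient.out (D₀.coGen ^ ((l + 1) / 2)) D₀.coGen
    D₀.l_prime D₀.coGen_not_mem D₀.five_le_l (coprime_six_of_prime l D₀.l_prime D₀.five_le_l) D₀.lineGen_ne_one
    D₀.card_tors_eq QuotientGroup.out_eq' hh

/-- **The printed §1 claims `ArrowCoveringClaims` at `regeom₃`** — DERIVED from `CuspGalois` + `ModLCuspLaws` by
abc-iut-L5-t1's `arrowCoveringClaims_pe_of_modLCuspLaws` (p448117), at a datum that ALSO carries the `l`-torsion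
monodromy (contrast: `¬ArrowCoveringClaims` at the 4-label `regeom`, `InitialThetaDataTorsionMonodromyModelInertia`).
[cite: Mochizuki2012, IUTchI §1 p.38] -/
theorem arrowCoveringClaimsRegeom₃ (D₀ : InitialThetaData F K Fbar E l Pb) : D₀.regeom₃.geom.pe.ArrowCoveringClaims :=
  D₀.regeom₃.arrowCoveringClaims_pe_of_modLCuspLaws D₀.cuspGaloisRegeom₃ D₀.modLCuspLawsRegeom₃

/-- **JOINT NON-VACUITY `{CG, M′, hL, hA}` AT ONE DATUM over the SAME `(V^bad_mod, V̲)`** (NV-L5 row «JOINT-NV-CG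
(l cusps)»): for every initial Θ-datum `D₀` there is `D` with `D.VbadMod = D₀.VbadMod`, `D.V = D₀.V`, carrying t1's cusp
Galois action `CG`, this lineage's `UnramifiedTorsionMonodromy` (`⊇ {M, hI}`), t1's laws `ModLCuspLaws` (`hL`) and the
printed claims `ArrowCoveringClaims` (`hA`) — the data/law binders of abc-iut-L5-d5's `Λ`-assembly and abc-iut-L5-t4's
kits except `hS`, jointly consistent with Def 3.1. [cite: Mochizuki2012, IUTchI Def 6.1 (v) p.158] -/
theorem exists_joint_cuspGalois_unramified_laws_claims (D₀ : InitialThetaData F K Fbar E l Pb) :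
    ∃ D : InitialThetaData F K Fbar E l Pb, D.VbadMod = D₀.VbadMod ∧ D.V = D₀.V ∧
      ∃ (_ : D.geom.pe.CuspGalois) (_ : D.UnramifiedTorsionMonodromy),
        D.geom.pe.ModLCuspLaws ∧ D.geom.pe.ArrowCoveringClaims :=
  ⟨D₀.regeom₃, rfl, rfl, D₀.cuspGaloisRegeom₃, D₀.unramifiedTorsionMonodromyRegeom₃, D₀.modLCuspLawsRegeom₃,
    D₀.arrowCoveringClaimsRegeom₃⟩

/-- The same in abc-iut-L5-d5's binder shape `{CG, M, hA, hI}` plus `hL`. [cite: Mochizuki2012, IUTchI Def 6.1 (v) p.158] -/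
theorem exists_joint_cuspGalois_torsionMonodromy_claims_tau_inertia (D₀ : InitialThetaData F K Fbar E l Pb) :
    ∃ D : InitialThetaData F K Fbar E l Pb, D.VbadMod = D₀.VbadMod ∧ D.V = D₀.V ∧
      ∃ (_ : D.geom.pe.CuspGalois) (M : D.TorsionMonodromy), D.geom.pe.ArrowCoveringClaims ∧ D.geom.pe.ModLCuspLaws ∧
        ∀ k ∈ D.geom.pe.inertia D.geom.pe.ε1, M.tau (D.geom.embK k) = 0 :=
  ⟨D₀.regeom₃, rfl, rfl, D₀.cuspGaloisRegeom₃, D₀.unramifiedTorsionMonodromyRegeom₃.toTorsionMonodromy,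
    D₀.arrowCoveringClaimsRegeom₃, D₀.modLCuspLawsRegeom₃, D₀.unramifiedTorsionMonodromyRegeom₃.tau_inertia_ε1⟩

end InitialThetaData

end Literature.IUT.HodgeTheaters

end
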